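import Summits.QuantumFields.BalabanUV.Beta.RemainderExplicitHistoryDiagonalMemoryZone

/-!
# RemainderExplicitHistoryDiagonalMemoryZoneCubic — ROAD P3, ORDER-0 PROFILE FAMILY: THE CUBIC BOUND ON THE POSITION EXCESS AND THE
# REDUCTION OF CENSUS (i′) TO ONE LINEAR A-PRIORI INEQUALITY — the trial gap of a coupling `g` at a discrepancy `D` is EXACTLY
# `D·g³∕(w(w+1))`, `w = √(1 + Dg²)`, so the position excess of the third file is at most `(D∕2)·(g_j³ − g_i³)` (purely algebraic), hence at
# most `(3∕2)g_j²(g_j − g_i)·D`; consequently, for two infrared-pinned runs of the family with a non-increasing profile of memory `A` and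
# `Wγ ≤ 2b`, the matched discrepancy is non-increasing at EVERY position as soon as `(3∕2)(g^A_j)²·(β^A_j − b)·d_j ≤ E_j` at the `A − 1`
# memory-zone positions (`β^A_j − b` the history part of A's β-function, `E_j` B's extra-age source; seat numerics: ratio ≤ 0.25, and ≤ 0.13 for
# the cubic form) — the inequality left to prove for census (i′) with `A ≥ 3` (station S-d4p3-g54-1 «the echo count», fourth file)

Cell `pub-balaban`, β-function sub-cell, BINDER row D4 «RemainderConst leaves for Bałaban's split» (`HOME/BINDER-OWNERS.md`; owner lineage
`b2b-balaban-beta-an4`; this file by co-owner #3 lineage `b2b-balaban-beta-d4-p3`, road P3 «the reduction road», generation 54, station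
S-d4p3-g54-1, fourth file; imports the third file `RemainderExplicitHistoryDiagonalMemoryZone`), β-FLOW TEAM duty (1); FREEZE (0) honoured
(def-free module in road P3's own `RemainderExplicit*` series; no leaf, no interface, no Literature file).  SOURCE OF THE SHAPES ONLY:
[Balaban1987RG1] (0.20) p. 256, (0.31) and Thm 2 p. 259, §5 p. 298.  [folklore] real analysis about ONE explicit toy family (ours), road P3's
ORDER-0 PROFILE FAMILY (generation 44).
HONEST FRAMING: *"Discharging BetaPertH makes Bałaban's UV stability UNCONDITIONAL — a real constructive-QFT result; it is NOT the continuum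
limit and NOT the Clay problem."*  THIS FILE DISCHARGES NOTHING OF THE KIND; nothing of Bałaban's (1.22) is asserted or constructed; row D4
class UNCHANGED (critical-path width 0; instance 0∕1; D4 DISCHARGE NO DATE); NOT B12 Thm 2, NOT BetaPertH, NOT continuum, NOT Clay.  HONEST
DEPENDENCY: continuum YM on T⁴ ⇐ BetaPertH ∧ nine spine estimates (0/9 proved); BetaPertH ⇐ (D1) ∧ (D4) ∧ CAP+tail; G-an2-4 gates asym, D1
and NE2/3/4.  ABSOLUTE RULE: nothing is cited as a fact.  All letters NOT-IN-PRINT; `BetaFlowAsPrinted S` records a Markov β_n only.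

WHAT IS PROVED ([folklore]; 0 sorry; 0 `def`).  §1 `trialGap_eq` (`g − 1∕√(1∕g² + D) = Dg³∕(w(w+1))`, `w = √(1+Dg²)`), **`excess_le_cube`**
(`0 < g ≤ g′`, `D ≥ 0`: the excess of the trial gaps is `≤ (D∕2)(g′³ − g³)`).  §2 `excess_le_cubic_sum` (the third file's position excess at `j` is
`≤ (d_j∕2)·Σ_{i<j} ρ(j−i)((g^A_j)³ − (g^A_i)³)`), `cubic_sum_le_histA` (`… ≤ 3(g^A_j)²·Σ_{i<j} ρ(j−i)(g^A_j − g^A_i)`).  §3 **`disc_succ_le_disc_of_cubic`**,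
**`disc_succ_le_disc_of_histA`** (non-increasing profile of memory `A`, `Wγ ≤ 2b`: the cubic, resp. linear, inequality on the memory zone ⇒
`d_{j+1} ≤ d_j` at every `j < K`).  THE LOCATED REMAINING INEQUALITY (analysis `HOME/b2b-balaban-beta-d4-p3/g54/I-PRIME-ANALYSIS-v2.md`):
`(3∕2)(g^A_j)²(β^A_j − b)·d_j ≤ E_j` for `1 ≤ j < min(A, K)`; the chain `β^A_j − b ≤ R_j(g^A_j − g^A_0)`, `g^A_j − g^A_0 ≤ g^B_{j+n} − g^B_{n−1}` (numerics,
ratio ≤ 0.9995, NOT proved), `d_j ≤` the third file's `disc_le_dropped_echo`, `U_j ≤ ρ(j+1)Σ_{l≥j}(h_l − h_{−1})` (non-increasing profile) and the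
integral bound `R_j(g^A_j)²Σ_{l≥j}(h_l − h_{−1}) ≤ 1∕2` would give a constant ≈ 0.75 + feedback share ≈ 0.9 — too tight to formalise as is; the
slack sits in the Lipschitz step near the pin (×0.5) and in the integral bound (measured ≤ 0.24 vs 1∕2).
-/

noncomputable section

open Finset Filter Topology

namespace Summit.QuantumFields.BalabanUV.Beta.RemainderExplicitHistoryDiagonalMemoryZoneCubic

open Literature.MathematicalPhysics.QuantumFieldTheory.Balaban1983to89
open Literature.MathematicalPhysics.QuantumFieldTheory.Balaban1983to89.FlowStep
open Literature.MathematicalPhysics.QuantumFieldTheory.Balaban1983to89.T4CouplingMatching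
open Literature.MathematicalPhysics.QuantumFieldTheory.Balaban1983to89.T4ContinuumCoupling
open Summit.QuantumFields.BalabanUV.Beta.RemainderExplicitHistoryDiagonalMonotone
open Summit.QuantumFields.BalabanUV.Beta.RemainderExplicitHistoryDiagonalWeights
open Summit.QuantumFields.BalabanUV.Beta.RemainderExplicitHistoryDiagonalTwoRun
open Summit.QuantumFields.BalabanUV.Beta.RemainderExplicitHistoryDiagonalWindow
open Summit.QuantumFields.BalabanUV.Beta.RemainderExplicitHistoryDiagonalOneStepMonotone
open Summit.QuantumFields.BalabanUV.Beta.RemainderExplicitHistoryDiagonalEchoMonotone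
open Summit.QuantumFields.BalabanUV.Beta.RemainderExplicitHistoryDiagonalMemoryZone

variable {β : HBeta} {b γ W : ℝ} {ρ : ℕ → ℝ}

/-! ## §1 The trial gap in closed form and the cubic bound on the position excess -/

/-- THE TRIAL GAP IN CLOSED FORM: for `g > 0`, `D ≥ 0`, with `w = √(1 + D·g²)`:
`g − 1∕√(1∕g² + D) = D·g³ ∕ (w·(w + 1))`. [folklore] -/
theorem trialGap_eq {g D : ℝ} (hg : 0 < g) (hD : 0 ≤ D) :
    g - 1 / Real.sqrt (1 / g ^ 2 + D) = D * g ^ 3 / (Real.sqrt (1 + D * g ^ 2) * (Real.sqrt (1 + D * g ^ 2) + 1)) := by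
  have hq : 0 < 1 + D * g ^ 2 := by positivity
  set w : ℝ := Real.sqrt (1 + D * g ^ 2) with hw
  have hw0 : 0 < w := Real.sqrt_pos.mpr hq
  have hwsq : w ^ 2 = 1 + D * g ^ 2 := Real.sq_sqrt hq.le
  have hinner : 1 / g ^ 2 + D = (1 + D * g ^ 2) / g ^ 2 := by field_simp
  have hsqrt : Real.sqrt (1 / g ^ 2 + D) = w / g := by
    rw [hinner, Real.sqrt_div' _ (pow_pos hg 2).le, Real.sqrt_sq hg.le]
  rw [hsqrt, one_div_div]
  have hw1 : 0 < w + 1 := by linarith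
  field_simp
  nlinarith [hwsq]

/-- **THE CUBIC BOUND ON THE POSITION EXCESS.**  For couplings `0 < g ≤ g'` and a discrepancy `D ≥ 0`:
`(g' − 1∕√(1∕g'² + D)) − (g − 1∕√(1∕g² + D)) ≤ (D∕2)·(g'³ − g³)` — by `trialGap_eq` the trial gap is `D·g³∕(w(w+1))` with `w = √(1 + Dg²) ≥ 1`
non-decreasing in `g`, so the excess of the larger coupling is at most `D(g'³ − g³)∕(w(w+1)) ≤ D(g'³ − g³)∕2`.  Purely algebraic (no calculus);
it is the exact version of generation 53's `(c_j − c_i)·d_j` with `c ≤ g³∕2`. [folklore] -/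
theorem excess_le_cube {g g' D : ℝ} (hg : 0 < g) (hgg : g ≤ g') (hD : 0 ≤ D) :
    (g' - 1 / Real.sqrt (1 / g' ^ 2 + D)) - (g - 1 / Real.sqrt (1 / g ^ 2 + D)) ≤ D / 2 * (g' ^ 3 - g ^ 3) := by
  have hg' : 0 < g' := lt_of_lt_of_le hg hgg
  rw [trialGap_eq hg hD, trialGap_eq hg' hD]
  set w : ℝ := Real.sqrt (1 + D * g ^ 2) with hw
  set w' : ℝ := Real.sqrt (1 + D * g' ^ 2) with hw'
  have hq : 0 < 1 + D * g ^ 2 := by positivity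
  have hq' : 0 < 1 + D * g' ^ 2 := by positivity
  have hw1 : 1 ≤ w := by
    rw [hw]
    exact (Real.le_sqrt zero_le_one hq.le).mpr (by nlinarith)
  have hww : w ≤ w' := Real.sqrt_le_sqrt (by nlinarith [pow_le_pow_left₀ hg.le hgg 2])
  have hw0 : 0 < w := by linarith
  have hw'0 : 0 < w' := by linarith
  have hg3 : g ^ 3 ≤ g' ^ 3 := pow_le_pow_left₀ hg.le hgg 3
  have hP : 0 < w * (w + 1) := by positivity
  have hP' : 0 < w' * (w' + 1) := by positivity
  -- the larger coupling has the larger denominator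
  have h1 : D * g' ^ 3 / (w' * (w' + 1)) ≤ D * g' ^ 3 / (w * (w + 1)) :=
    div_le_div_of_nonneg_left (by positivity) hP (by nlinarith)
  -- the common denominator is at least 2
  have h2 : D * g' ^ 3 / (w * (w + 1)) - D * g ^ 3 / (w * (w + 1)) ≤ D / 2 * (g' ^ 3 - g ^ 3) := by
    rw [← sub_div, ← mul_sub, div_le_iff₀ hP]
    have hnum : 0 ≤ D * (g' ^ 3 - g ^ 3) := mul_nonneg hD (by linarith)
    have hww2 : 2 ≤ w * (w + 1) := by nlinarith
    nlinarith [mul_le_mul_of_nonneg_left hww2 hnum]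
  linarith

/-! ## §2 Sufficient forms of the memory-zone criterion -/

/-- **THE CUBIC FORM IMPLIES THE CRITERION.**  Two runs (A: `K` steps, B: `K + n` steps, positive couplings increasing along A, pinned) and a
position `j`; write `D = d_j = 1∕(g^B_{j+n})² − 1∕(g^A_j)² ≥ 0`.  THEN the position excess of the third file is at most the cubic history variation:
`Σ_{i<j} ρ(j−i)·[(g^A_j − g^B_{j+n}) − (g^A_i − 1∕√(1∕(g^A_i)² + D))] ≤ (D∕2)·Σ_{i<j} ρ(j−i)·((g^A_j)³ − (g^A_i)³)` (`excess_le_cube` term by term,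
`g^B_{j+n} = 1∕√(1∕(g^A_j)² + D)`). [folklore] -/
theorem excess_le_cubic_sum
    (hρ0 : ∀ a, 0 ≤ ρ a) {n j : ℕ} {gA gB : ℕ → ℝ} (hApos : ∀ i, i ≤ j → 0 < gA i) (hAmono : ∀ i, i ≤ j → gA i ≤ gA j)
    (hBpos : 0 < gB (j + n)) (hD : 0 ≤ 1 / (gB (j + n)) ^ 2 - 1 / (gA j) ^ 2) :
    ∑ i ∈ range j, ρ (j - i) * ((gA j - gB (j + n))
        - (gA i - 1 / Real.sqrt (1 / (gA i) ^ 2 + (1 / (gB (j + n)) ^ 2 - 1 / (gA j) ^ 2))))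
      ≤ (1 / (gB (j + n)) ^ 2 - 1 / (gA j) ^ 2) / 2 * ∑ i ∈ range j, ρ (j - i) * ((gA j) ^ 3 - (gA i) ^ 3) := by
  set D : ℝ := 1 / (gB (j + n)) ^ 2 - 1 / (gA j) ^ 2 with hD_def
  -- B's coupling at the matched position IS the trial coupling of `g^A_j` at the discrepancy `D`
  have hBeq : gB (j + n) = 1 / Real.sqrt (1 / (gA j) ^ 2 + D) := by
    have : 1 / (gA j) ^ 2 + D = (1 / gB (j + n)) ^ 2 := by rw [hD_def, one_div_pow]; ring
    rw [this, Real.sqrt_sq (by positivity), one_div_one_div]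
  rw [Finset.mul_sum]
  refine Finset.sum_le_sum fun i hi => ?_
  have hi' := Finset.mem_range.mp hi
  have hex := excess_le_cube (hApos i hi'.le) (hAmono i hi'.le) hD
  rw [← hBeq] at hex
  have := mul_le_mul_of_nonneg_left hex (hρ0 (j - i))
  calc ρ (j - i) * ((gA j - gB (j + n)) - (gA i - 1 / Real.sqrt (1 / (gA i) ^ 2 + D)))
      ≤ ρ (j - i) * (D / 2 * ((gA j) ^ 3 - (gA i) ^ 3)) := this
    _ = D / 2 * (ρ (j - i) * ((gA j) ^ 3 - (gA i) ^ 3)) := by ring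

/-- THE LINEAR FORM DOMINATES THE CUBIC ONE: for couplings `0 < g_i ≤ g_j` (`i < j`) and `ρ ≥ 0`,
`Σ_{i<j} ρ(j−i)·(g_j³ − g_i³) ≤ 3·g_j²·Σ_{i<j} ρ(j−i)·(g_j − g_i)` (`g_j³ − g_i³ = (g_j − g_i)(g_j² + g_jg_i + g_i²)`) — the cubic history
variation is at most `3g_j²` times the history part `β^A_j − b = Σ_{a≤j} ρ(a)(g_j − g_{j−a})` of A's β-function at `j`. [folklore] -/
theorem cubic_sum_le_histA (hρ0 : ∀ a, 0 ≤ ρ a) {j : ℕ} {gA : ℕ → ℝ} (hApos : ∀ i, i ≤ j → 0 < gA i)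
    (hAmono : ∀ i, i ≤ j → gA i ≤ gA j) :
    ∑ i ∈ range j, ρ (j - i) * ((gA j) ^ 3 - (gA i) ^ 3) ≤ 3 * (gA j) ^ 2 * ∑ i ∈ range j, ρ (j - i) * (gA j - gA i) := by
  rw [Finset.mul_sum]
  refine Finset.sum_le_sum fun i hi => ?_
  have hi' := Finset.mem_range.mp hi
  have hgi := hApos i hi'.le
  have hle := hAmono i hi'.le
  have hcube : (gA j) ^ 3 - (gA i) ^ 3 ≤ 3 * (gA j) ^ 2 * (gA j - gA i) := by
    nlinarith [mul_nonneg (sub_nonneg.2 hle) (mul_nonneg hgi.le (sub_nonneg.2 hle)),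
      mul_nonneg (sub_nonneg.2 hle) (mul_nonneg (hApos j le_rfl).le (sub_nonneg.2 hle))]
  calc ρ (j - i) * ((gA j) ^ 3 - (gA i) ^ 3) ≤ ρ (j - i) * (3 * (gA j) ^ 2 * (gA j - gA i)) :=
        mul_le_mul_of_nonneg_left hcube (hρ0 _)
    _ = 3 * (gA j) ^ 2 * (ρ (j - i) * (gA j - gA i)) := by ring

/-! ## §3 The reduction of census (i′) to the cubic ∕ linear a-priori inequality on the memory zone -/

/-- **CUBIC REDUCTION.**  Road P3's order-0 profile family in ]0,γ] with a profile non-increasing on the positive ages and memory `A`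
(`ρ(a) = 0` for `a > A`), `Σ_{a<N} ρ(a) ≤ W`, `Wγ ≤ 2b`; two pinned runs A: `K` ∕ B: `K + n`.  IF at every memory-zone position `1 ≤ j < A`,
`j < K`: `(d_j∕2)·Σ_{i<j} ρ(j−i)·((g^A_j)³ − (g^A_i)³) ≤ E_j = Σ_{i<n} ρ(j+n−i)(g^B_{j+n} − g^B_i)`, THEN `d_{j+1} ≤ d_j` at EVERY `j < K`
(`excess_le_cubic_sum` feeds the third file's `disc_succ_le_disc_of_criterion`).  Seat numerics: the cubic form has ratio ≤ 0.13 to `E_j` in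
1 632 cases (it is the position excess to within 1 %). [cite: Balaban1987RG1, (0.20) p.256, (0.31) and Thm 2 p.259] -/
theorem disc_succ_le_disc_of_cubic
    (hβ : ∀ (k : ℕ) (p : Fin (k + 1) → ℝ),
      β k p = b + ∑ i : Fin (k + 1), ρ (k - i) * min (p (Fin.last k)) (|p (Fin.last k) - p i|))
    (hb : 0 < b) (hρ0 : ∀ a, 0 ≤ ρ a) (hρW : ∀ n, ∑ a ∈ range n, ρ a ≤ W) (hmono : ∀ a, 1 ≤ a → ρ (a + 1) ≤ ρ a)
    (hWγ : W * γ ≤ 2 * b) {A : ℕ} (hρA : ∀ a, A < a → ρ a = 0) {K n : ℕ} {gA gB : ℕ → ℝ} (hA : RGEqH K β gA)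
    (hB : RGEqH (K + n) β gB) (hAbox : ∀ k, k ≤ K → 0 < gA k ∧ gA k ≤ γ) (hBpos : ∀ k, k ≤ K + n → 0 < gB k)
    (hpin : gA K = gB (K + n))
    (hcubic : ∀ j, 1 ≤ j → j < A → j < K →
      (1 / (gB (j + n)) ^ 2 - 1 / (gA j) ^ 2) / 2 * ∑ i ∈ range j, ρ (j - i) * ((gA j) ^ 3 - (gA i) ^ 3)
        ≤ ∑ i ∈ range n, ρ (j + n - i) * (gB (j + n) - gB i)) :
    ∀ j, j < K → 1 / (gB (j + 1 + n)) ^ 2 - 1 / (gA (j + 1)) ^ 2 ≤ 1 / (gB (j + n)) ^ 2 - 1 / (gA j) ^ 2 := by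
  have hApos : ∀ k, k ≤ K → 0 < gA k := fun k hk => (hAbox k hk).1
  have hdom := invSq_le_invSq_shift_run hβ hb hρ0 hA hB hApos hBpos hpin
  refine disc_succ_le_disc_of_criterion hβ hb hρ0 hρW hmono hWγ hρA hA hB hAbox hBpos hpin fun j hj1 hjA hjK => ?_
  have hD : 0 ≤ 1 / (gB (j + n)) ^ 2 - 1 / (gA j) ^ 2 := by linarith [hdom j hjK.le]
  exact (excess_le_cubic_sum hρ0 (fun i hi => hApos i (by omega))
    (fun i hi => run_mono_orderZero hβ hb hρ0 hA hApos hi hjK.le) (hBpos (j + n) (by omega)) hD).trans (hcubic j hj1 hjA hjK)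

/-- **LINEAR REDUCTION (the history part of A's β-function).**  Same setting.  IF at every memory-zone position `1 ≤ j < A`, `j < K`:
`(3∕2)·(g^A_j)²·(Σ_{i<j} ρ(j−i)(g^A_j − g^A_i))·d_j ≤ E_j` — i.e. `(3∕2)(g^A_j)²·(β^A_j − b)·d_j ≤ E_j`, the current discrepancy times the
ultraviolet-suppressed history part of A's β-function against B's extra-age source — THEN `d_{j+1} ≤ d_j` at EVERY `j < K` (`cubic_sum_le_histA` +
`disc_succ_le_disc_of_cubic`).  Seat numerics: ratio ≤ 0.25 in 1 632 cases.  THIS is the inequality left to prove for census (i′) with memory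
`A ≥ 3`. [cite: Balaban1987RG1, (0.20) p.256, (0.31) and Thm 2 p.259] -/
theorem disc_succ_le_disc_of_histA
    (hβ : ∀ (k : ℕ) (p : Fin (k + 1) → ℝ),
      β k p = b + ∑ i : Fin (k + 1), ρ (k - i) * min (p (Fin.last k)) (|p (Fin.last k) - p i|))
    (hb : 0 < b) (hρ0 : ∀ a, 0 ≤ ρ a) (hρW : ∀ n, ∑ a ∈ range n, ρ a ≤ W) (hmono : ∀ a, 1 ≤ a → ρ (a + 1) ≤ ρ a)
    (hWγ : W * γ ≤ 2 * b) {A : ℕ} (hρA : ∀ a, A < a → ρ a = 0) {K n : ℕ} {gA gB : ℕ → ℝ} (hA : RGEqH K β gA)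
    (hB : RGEqH (K + n) β gB) (hAbox : ∀ k, k ≤ K → 0 < gA k ∧ gA k ≤ γ) (hBpos : ∀ k, k ≤ K + n → 0 < gB k)
    (hpin : gA K = gB (K + n))
    (hlin : ∀ j, 1 ≤ j → j < A → j < K →
      3 / 2 * (gA j) ^ 2 * (∑ i ∈ range j, ρ (j - i) * (gA j - gA i)) * (1 / (gB (j + n)) ^ 2 - 1 / (gA j) ^ 2)
        ≤ ∑ i ∈ range n, ρ (j + n - i) * (gB (j + n) - gB i)) :
    ∀ j, j < K → 1 / (gB (j + 1 + n)) ^ 2 - 1 / (gA (j + 1)) ^ 2 ≤ 1 / (gB (j + n)) ^ 2 - 1 / (gA j) ^ 2 := by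
  have hApos : ∀ k, k ≤ K → 0 < gA k := fun k hk => (hAbox k hk).1
  have hdom := invSq_le_invSq_shift_run hβ hb hρ0 hA hB hApos hBpos hpin
  refine disc_succ_le_disc_of_cubic hβ hb hρ0 hρW hmono hWγ hρA hA hB hAbox hBpos hpin fun j hj1 hjA hjK => ?_
  have hD : 0 ≤ 1 / (gB (j + n)) ^ 2 - 1 / (gA j) ^ 2 := by linarith [hdom j hjK.le]
  have hc := cubic_sum_le_histA hρ0 (fun i hi => hApos i (by omega)) (fun i hi => run_mono_orderZero hβ hb hρ0 hA hApos hi hjK.le)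
    (j := j)
  have h1 : (1 / (gB (j + n)) ^ 2 - 1 / (gA j) ^ 2) / 2 * ∑ i ∈ range j, ρ (j - i) * ((gA j) ^ 3 - (gA i) ^ 3)
      ≤ (1 / (gB (j + n)) ^ 2 - 1 / (gA j) ^ 2) / 2 * (3 * (gA j) ^ 2 * ∑ i ∈ range j, ρ (j - i) * (gA j - gA i)) :=
    mul_le_mul_of_nonneg_left hc (by positivity)
  refine h1.trans (le_of_eq_of_le ?_ (hlin j hj1 hjA hjK))
  ring

end Summit.QuantumFields.BalabanUV.Beta.RemainderExplicitHistoryDiagonalMemoryZoneCubic
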